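import Mathlib

/-!
# Lemma N.3 of route/T4N-route-3.md (Tier 5, N2): the four infinity types lie in distinct orbits

T4N §4.5 (Lemma N.3) argues that the four residual Hecke characters `ξ₁₁₁, ξ₁₀₀, ξ₁₀₁, ξ₁₁₀` are
pairwise unrelated by the symmetries that preserve (non-)vanishing of the central `L`-value —
Galois conjugation `ξ ↦ ξ∘γ` (`γ ∈ Gal(E/ℚ) = ⟨g⟩`, with `g²` permuting the three complex places
cyclically and `g³ = c` the complex conjugation), `ξ ↦ ξ^c` and inversion `ξ ↦ ξ⁻¹` — because these
symmetries act on the infinity type `(m₁, m₂, m₃) ∈ ℤ³` through cyclic permutations and a global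
sign flip, and the four types

  `ξ₁₁₁ : (−1, +1, +1)`, `ξ₁₀₀ : (−1, −5, −5)`, `ξ₁₀₁ : (−1, +1, −5)`, `ξ₁₁₀ : (−1, −5, +1)`

(route-2, MEMO §11.2) lie in four distinct orbits of that group of order 6.  This file
kernel-checks the orbit computation: `orbit v` is the set of the six images of `v` under
`⟨shift⟩ × ⟨neg⟩`, and `orbits_pairwise_disjoint` says that no type lies in the orbit of another.
The identification of the symmetries with `shift` / `neg` is T4N §4.5's (prose) input.
-/

namespace Summit.Ventures.HodgeRepro2.InfinityTypeOrbits

/-- The cyclic shift `(m₁, m₂, m₃) ↦ (m₂, m₃, m₁)` (the action of `g²` on the complex places). -/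
def shift (v : Fin 3 → ℤ) : Fin 3 → ℤ := ![v 1, v 2, v 0]

/-- The six images of `v` under the group generated by the cyclic shift and the global sign
flip (`c`, inversion): the orbit of the infinity type. -/
def orbit (v : Fin 3 → ℤ) : Finset (Fin 3 → ℤ) :=
  {v, shift v, shift (shift v), -v, -shift v, -shift (shift v)}

/-- The infinity type of `ξ₁₁₁`. -/
def t111 : Fin 3 → ℤ := ![-1, 1, 1]
/-- The infinity type of `ξ₁₀₀`. -/
def t100 : Fin 3 → ℤ := ![-1, -5, -5]
/-- The infinity type of `ξ₁₀₁`. -/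
def t101 : Fin 3 → ℤ := ![-1, 1, -5]
/-- The infinity type of `ξ₁₁₀`. -/
def t110 : Fin 3 → ℤ := ![-1, -5, 1]

/-- `orbit` is closed under the generators (so it is the full orbit of the group of order 6). -/
theorem shift_mem_orbit (v : Fin 3 → ℤ) : shift v ∈ orbit v := by
  simp [orbit]

/-- `shift³ = id`: the shift has order 3. -/
theorem shift_shift_shift (v : Fin 3 → ℤ) : shift (shift (shift v)) = v := by
  ext i
  fin_cases i <;> rfl

/-- `−v ∈ orbit v`. -/
theorem neg_mem_orbit (v : Fin 3 → ℤ) : -v ∈ orbit v := by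
  simp [orbit]

/-- **Lemma N.3, the orbit computation.** The four infinity types lie in pairwise distinct orbits:
no type is a cyclic shift or a negated cyclic shift of another. -/
theorem orbits_pairwise_disjoint :
    t100 ∉ orbit t111 ∧ t101 ∉ orbit t111 ∧ t110 ∉ orbit t111 ∧
    t101 ∉ orbit t100 ∧ t110 ∉ orbit t100 ∧ t110 ∉ orbit t101 := by
  decide

/-- In particular the four types are pairwise distinct. -/
theorem types_pairwise_ne :
    t111 ≠ t100 ∧ t111 ≠ t101 ∧ t111 ≠ t110 ∧ t100 ≠ t101 ∧ t100 ≠ t110 ∧ t101 ≠ t110 := by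
  decide

end Summit.Ventures.HodgeRepro2.InfinityTypeOrbits
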